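import Mathlib
import Summits.ValiantsHypothesis.ValiantsHypothesis.Theses.BarrierLever
import Literature.Computability.AlgebraicComplexity.ArithCircuitProofs

/-!
# `SingleSizeEquations` (stmt-ValiantsHypothesis-8749): the two reductions that locate the item

Route `BarrierLever`, support item `SingleSizeEquations` (∀ b ∃ a n₀ ∀ n ≥ n₀: a NONZERO level-`a`
boolean sum `E = boolSum H` — `q`, `L(H)`, `deg H ≤ N^a`, `N = C(2n,n)` — vanishing at
`coeff(f)` for every `f` of degree `≤ n` and circuit size `≤ n^b`). This helper file records,
kernel-checked, where the item sits between the route's crux and the barrier hypothesis: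

* `singleSizeEquations_of_definableEquations` — the crux `DefinableEquations` (one level `a`
  for every `b`) implies the item (swap the quantifiers).
* `boolSum_rename_inl`, `distinguisher_isBoolSum` — every distinguisher
  `D ∈ Distinguishers ℂ n a` is itself a level-`a` boolean sum with `q = 0` boolean variables
  (`H = rename Sum.inl D`, same complexity and degree bounds).
* `isSuccinctHittingSet_io_of_not_singleSizeEquations` — hence the NEGATION of the item yields one
  size exponent `b` such that for EVERY level `a`, for infinitely many `n`, the coefficient
  vectors of `SmallCircuits ℂ n b` hit every nonzero `D ∈ Distinguishers ℂ n a`: an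
  infinitely-often, uniform-in-`b` form of FSV's Question 6 (`SuccinctHittingSetsForVP`), i.e. a
  "VP-succinct hitting-set generator for VP(N)" in the sense of Chatterjee–Tengse
  (arXiv:2309.07612, Def. 1: hitting for infinitely many `n`), whose existence they show implies
  `VP ≠ VPSPACE`-type separations (Thm. 1.1). Conversely the item itself at `b = 2` is a
  `VNP(2^{O(n)})`-explicit family of equations for size-`n²` circuits, the open direction 2 of
  arXiv:2309.07612 §1.3. Neither direction is claimed here; these are the formal anchors of the
  prover's `verdict: open-problem` note on the item.

Elementary; no new definitions, no named facts.
-/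

-- `Summit.ValiantsHypothesis.ValiantsHypothesis.…` repeats a component by the D-0017 layout
-- (single-conjunct summit), which the `dupNamespace` linter flags; the name is mandated.
set_option linter.dupNamespace false

namespace Summit.ValiantsHypothesis.ValiantsHypothesis.Theorems.SingleSizeEquations

open Literature.Computability.AlgebraicComplexity Literature.Barriers.ValiantsHypothesis
open Summit.ValiantsHypothesis.ValiantsHypothesis.Theses.BarrierLever

/-- The crux `DefinableEquations` (ONE level `a` serving every size exponent `b`) implies the
support item `SingleSizeEquations` (a level `a` depending on `b`): swap `∃ a` past `∀ b`.
[folklore] -/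
theorem singleSizeEquations_of_definableEquations (h : DefinableEquations) :
    SingleSizeEquations := by
  obtain ⟨a, ha⟩ := h
  intro b
  obtain ⟨n₀, hn₀⟩ := ha b
  exact ⟨a, n₀, hn₀⟩

/-- An empty boolean sum (`q = 0`) of a polynomial in the coefficient variables only is that
polynomial: `boolSum (rename Sum.inl D) = D` (Bürgisser 2000, Def. 2.5 with `m = 0`).
[folklore] -/
theorem boolSum_rename_inl {σ : Type*} (D : MvPolynomial σ ℂ) :
    boolSum (m := 0) (MvPolynomial.rename Sum.inl D) = D := by
  rw [boolSum, Fintype.sum_unique, MvPolynomial.aeval_rename, Sum.elim_comp_inl,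
    MvPolynomial.aeval_X_left, AlgHom.coe_id, id_eq]

/-- Every distinguisher is a level-`a` boolean sum with no boolean variables: for
`D ∈ Distinguishers ℂ n a` the polynomial `H = rename Sum.inl D` in the variables
`degLEMonomials n ⊕ Fin 0` has `L(H) ≤ N^a`, `deg H ≤ N^a` and `boolSum H = D`
(`L(rename e f) ≤ L(f)`, Bürgisser 2000 Rem. 2.2; `deg (rename e f) ≤ deg f`). [folklore] -/
theorem distinguisher_isBoolSum {n a : ℕ} {D : MvPolynomial (degLEMonomials n) ℂ}
    (hD : D ∈ Distinguishers ℂ n a) :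
    complexity (MvPolynomial.rename (Sum.inl : _ → _ ⊕ Fin 0) D) ≤ (Nat.choose (2 * n) n) ^ a ∧
      (MvPolynomial.rename (Sum.inl : _ → _ ⊕ Fin 0) D).totalDegree ≤ (Nat.choose (2 * n) n) ^ a ∧
      boolSum (MvPolynomial.rename (Sum.inl : _ → _ ⊕ Fin 0) D) = D := by
  simp only [Distinguishers, Set.mem_setOf_eq] at hD
  exact ⟨(complexity_rename_le_holds' _ _).trans hD.1,
    (MvPolynomial.totalDegree_rename_le _ _).trans hD.2, boolSum_rename_inl D⟩

/-- **What refuting the item would prove.** If `SingleSizeEquations` fails, then there is ONE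
size exponent `b` such that for every distinguisher level `a` and infinitely many `n` the
coefficient vectors of `SmallCircuits ℂ n b` (degree `≤ n`, size `≤ n^b`) form a succinct hitting
set for `Distinguishers ℂ n a` (size and degree `≤ N^a`, `N = C(2n,n)`) — FSV Question 6
answered "yes" infinitely often with `b` uniform in `a` (a `VP`-succinct hitting-set generator
for `VP(N)` in the sense of Chatterjee–Tengse, arXiv:2309.07612 Def. 1). The failure of the item
even says more (the same `f`'s hit all nonzero level-`a` BOOLEAN SUMS, i.e. `VNP(N)`); this
corollary keeps only the distinguishers, via `distinguisher_isBoolSum`. [folklore] -/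
theorem isSuccinctHittingSet_io_of_not_singleSizeEquations (h : ¬ SingleSizeEquations) :
    ∃ b : ℕ, ∀ a n₀ : ℕ, ∃ n : ℕ, n₀ ≤ n ∧
      IsSuccinctHittingSet (degLEMonomials n) (SmallCircuits ℂ n b) (Distinguishers ℂ n a) := by
  unfold SingleSizeEquations at h
  push Not at h
  obtain ⟨b, hb⟩ := h
  refine ⟨b, fun a n₀ => ?_⟩
  obtain ⟨n, hn, hall⟩ := hb a n₀
  refine ⟨n, hn, fun D hD hD0 => ?_⟩
  obtain ⟨hc, hdeg, hsum⟩ := distinguisher_isBoolSum hD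
  have h0 : (0 : ℕ) ≤ (Nat.choose (2 * n) n) ^ a := Nat.zero_le _
  obtain ⟨f, hf, hne⟩ := hall 0 h0 _ hc hdeg (by rwa [hsum])
  exact ⟨f, hf, by rwa [hsum] at hne⟩

/-- The same conclusion with the full strength of the negation kept: one `b` such that for every
`a`, infinitely often, EVERY nonzero level-`a` boolean sum (`q ≤ N^a` boolean variables,
`L(H), deg H ≤ N^a`) is nonzero at the coefficient vector of some `f ∈ SmallCircuits ℂ n b` —
the coefficient vectors of size-`n^b` circuits would be a succinct hitting set against `VNP(N)`,
not just `VP(N)`. (Pure logic: the negation of the item, unfolded.) [folklore] -/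
theorem boolSum_hitting_io_of_not_singleSizeEquations (h : ¬ SingleSizeEquations) :
    ∃ b : ℕ, ∀ a n₀ : ℕ, ∃ n : ℕ, n₀ ≤ n ∧ ∀ q : ℕ, q ≤ (Nat.choose (2 * n) n) ^ a →
      ∀ H : MvPolynomial (↥(degLEMonomials n) ⊕ Fin q) ℂ,
        complexity H ≤ (Nat.choose (2 * n) n) ^ a → H.totalDegree ≤ (Nat.choose (2 * n) n) ^ a →
        boolSum H ≠ 0 →
        ∃ f ∈ SmallCircuits ℂ n b,
          MvPolynomial.eval (coeffVector (degLEMonomials n) f) (boolSum H) ≠ 0 := by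
  unfold SingleSizeEquations at h
  push Not at h
  obtain ⟨b, hb⟩ := h
  refine ⟨b, fun a n₀ => ?_⟩
  obtain ⟨n, hn, hall⟩ := hb a n₀
  exact ⟨n, hn, fun q hq H hc hd h0 => hall q hq H hc hd h0⟩

end Summit.ValiantsHypothesis.ValiantsHypothesis.Theorems.SingleSizeEquations
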